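import Literature.Algebra.EuclideanLattices.LatticeGeometry
import Literature.Algebra.EuclideanLattices.GaussianLatticeTails
import Literature.Algebra.EuclideanLattices.SuccessiveMinimaProofs
import Mathlib.Analysis.InnerProductSpace.Projection.FiniteDimensional
import Mathlib.Analysis.Complex.ExponentialBounds
import Mathlib.Analysis.Real.Pi.Bounds
import HarnessLib

/-!
# Banaszczyk's transference theorem `λᵢ(L) · λ_{n+1-i}(L*) ≤ n` — discharge of pqc.S24 (upper bound)

Theorems-only companion of `Literature/Algebra/EuclideanLattices/LatticeGeometry.lean`, discharging the
named fact `Literature.Algebra.EuclideanLattices.successiveMinimum_mul_dual_le` (pqc.S24, Banaszczyk's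
transference theorem) by `successiveMinimum_mul_dual_le_holds`: for a full-rank lattice `L` in an
`n`-dimensional real inner product space and `1 ≤ i ≤ n`, `λᵢ(L) · λ_{n+1-i}(L*) ≤ n`. As a by-product
the `i = 1` corollary `minNorm_mul_successiveMinimum_dual_le` (`λ₁(L) · λₙ(L*) ≤ n`) is discharged too
(`minNorm_mul_successiveMinimum_dual_le_holds`). Kept in a sibling file because the proof imports the
Gaussian/Poisson machinery of `GaussianLatticeSums.lean` / `GaussianLatticeTails.lean`, which the
statement file does not.

## Source

W. Banaszczyk, *New bounds in some transference theorems in the geometry of numbers*, Math. Ann.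
**296** (1993) 625–635, Theorem (2.1), p. 631: "Let `L` be an arbitrary lattice in `ℝⁿ`, `n ≥ 1`.
Then `λᵢ(L) λ_{n-i+1}(L*) ≤ n` (`i = 1, …, n`)." (`lit read paper:doi-10-1007-bf01445125`, pp. 631–632
for the proof, §1 pp. 627–630 for the lemmas). No discrepancy between the vendored statement and the
source was found (the vendored index `n + 1 - i` with `1 ≤ i ≤ n` is Banaszczyk's `n - i + 1`).

## Proof (Banaszczyk's, pp. 631–632, with the constants retuned so that one argument covers all `n ≥ 2`)

Banaszczyk treats `n = 1` (`λ₁(L)λ₁(L*) = 1`) and `n = 2` (`λ₁(L)λ₂(L*) ≤ 2/√3`) separately and runs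
the Fourier argument for `n ≥ 3` with radii `(3/4)√n`, `(4/3)√n` and `‖u‖ = 3^{-1/2}`. We keep his
argument verbatim in structure but choose radii `(5/4)·s√n`, `(4/5)·√n/s` and `‖u‖ = (9/20)·s√n`
(growing with `n`), which makes the same estimates contradictory already for `n = 2`; only `n = 1` is
treated separately (elementary: a shortest vector `v` generates `L`, and `v/‖v‖² ∈ L*`).

For `n ≥ 2`, write `P = λᵢ(L)`, `Q = λ_{n+1-i}(L*)` and suppose `P Q > n`. Pick radii `r₁ < P`,
`r₂ < Q` with `r₁ r₂ = n`. By the definition of the successive minima as infima, the lattice vectors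
of norm `≤ r₁` span a subspace `M` of dimension `< i` and the dual vectors of norm `≤ r₂` span `N` of
dimension `< n + 1 - i` (`finrank_span_inter_closedBall_lt_of_lt_successiveMinimum`), so
`dim M + dim N < n` and there is a vector `u ⊥ M, N` of any prescribed length
(`exists_norm_eq_inner_eq_zero_of_finrank_add_lt`; Banaszczyk: "`dim M⊥ + dim N⊥ ≥ n + 1`"). With the
Gaussian `ρ_s(x) = e^{-π‖x‖²/s²}`, `s = (4/5)√n / r₂` (so `r₂ = (4/5)√n/s`, `r₁ = (5/4) s √n`) and
`‖u‖ = (9/25) r₁`: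
* (Banaszczyk's (11)) since `u ⊥ N`, `cos(2π⟪u, w⟫) = 1` for the dual vectors `w` with `‖w‖ ≤ r₂`, and
  `≥ -1` for the others, which lie in the tail `‖w‖ ≥ (4/5)·(1/s)·√n`; Lemma 1.5(i)
  (`tsum_indicator_gaussianFunction_le`) gives
  `∑_{w ∈ L*} ρ_{1/s}(w) cos(2π⟪u, w⟫) ≥ (1 - 2Bⁿ) ρ_{1/s}(L*)`, `B = (4/5)√(2πe) e^{-16π/25}`
  (`tsum_gaussianFunction_mul_cos_ge`);
* (Banaszczyk's (12)–(13)) since `u ⊥ M`, `ρ_s(y - u) = ρ_s(u) ρ_s(y)` for the lattice vectors with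
  `‖y‖ ≤ r₁`, while the others satisfy `‖y - u‖ ≥ r₁ - ‖u‖ = (4/5) s √n` and fall under Lemma 1.5(ii)
  (`tsum_indicator_gaussianFunction_sub_le`): `ρ_s(L - u) ≤ (ρ_s(u) + Bⁿ) ρ_s(L)`
  (`tsum_gaussianFunction_sub_le_of_inner_eq_zero`);
* (Banaszczyk's Cor. 1.2, the Poisson identity `σ̂_L = φ_{L*}`) `ρ_s(L - u)/ρ_s(L) =
  (∑_{w ∈ L*} ρ_{1/s}(w) cos(2π⟪u, w⟫))/ρ_{1/s}(L*)` (`tsum_gaussianFunction_sub_div_eq`).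
Hence `1 - 2Bⁿ ≤ ρ_s(u) + Bⁿ = e^{-81πn/400} + Bⁿ`, impossible for `n ≥ 2` since
`e^{-81π/200} ≤ 0.29` and `B² ≤ 0.2` (`exp_neg_pi_mul_le`, `banaszczykConst_four_fifths_sq_le`).

## References

* W. Banaszczyk, *New bounds in some transference theorems in the geometry of numbers*, Math. Ann.
  296 (1993) 625–635, Thm 2.1 (p. 631), Lemma 1.1 / Cor. 1.2 (pp. 627–628), Lemma 1.5 (p. 630)
  [Banaszczyk1993].
* D. Micciancio, O. Regev, *Worst-case to average-case reductions based on Gaussian measures*,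
  SIAM J. Comput. 37 (2007), Lemma 2.10 (the form of Lemma 1.5 used here) [MicciancioRegev2007].
-/

noncomputable section

open Module Metric MeasureTheory
open scoped Real InnerProductSpace

namespace Literature.Algebra.EuclideanLattices

/-! ### Numerical constants -/

/-- `1/√(2π) ≤ 4/5` (indeed `1/√(2π) ≈ 0.399`; we use `√(2π) ≥ 2`): the radius `(4/5)·s√n` is in the
range of Banaszczyk's Lemma 1.5. [cite: Banaszczyk1993, Lemma 1.5] -/
theorem one_div_sqrt_two_pi_le_four_fifths : 1 / Real.sqrt (2 * π) ≤ 4 / 5 := by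
  have h2 : (2 : ℝ) ≤ Real.sqrt (2 * π) :=
    Real.le_sqrt_of_sq_le (by nlinarith [Real.pi_gt_three])
  rw [div_le_iff₀ (by positivity)]
  linarith

/-- `e^{-81π/200} ≤ 29/100` (the square of the factor `ρ_s(u)^{1/n} = e^{-81π/400}` of the proof):
`81π/200 ≥ 1.27234` and `e^{1.27234} ≥ e · (1 + 0.27234 + 0.27234²/2) ≥ 100/29`.
[cite: Banaszczyk1993, Thm 2.1 (proof, (13))] -/
theorem exp_neg_pi_mul_le : Real.exp (-(81 * π / 400)) ^ 2 ≤ 29 / 100 := by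
  have hπ := Real.pi_gt_d6
  have hexp : (100 / 29 : ℝ) ≤ Real.exp (81 * π / 200) := by
    calc (100 / 29 : ℝ) ≤ 2.7182818283 * (1 + 0.27234 + 0.27234 ^ 2 / 2) := by norm_num
      _ ≤ Real.exp 1 * Real.exp 0.27234 :=
          mul_le_mul Real.exp_one_gt_d9.le (Real.quadratic_le_exp_of_nonneg (by norm_num))
            (by norm_num) (Real.exp_pos _).le
      _ = Real.exp (1 + 0.27234) := (Real.exp_add _ _).symm
      _ ≤ Real.exp (81 * π / 200) := Real.exp_le_exp.2 (by linarith)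
  rw [← Real.exp_nat_mul, show ((2 : ℕ) : ℝ) * -(81 * π / 400) = -(81 * π / 200) by push_cast; ring,
    Real.exp_neg]
  calc (Real.exp (81 * π / 200))⁻¹ ≤ (100 / 29 : ℝ)⁻¹ := inv_anti₀ (by norm_num) hexp
    _ = 29 / 100 := by norm_num

/-- The square of Banaszczyk's tail constant at `c = 4/5`: `B² = (16/25)·2πe·e^{-32π/25} ≤ 1/5`
(numerically `B² ≈ 0.196`): `2πe ≤ 17.08` and `e^{32π/25} ≥ e⁴ · (1 + 0.02123) ≥ 55.75`.
[cite: Banaszczyk1993, Lemma 1.5] -/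
theorem banaszczykConst_four_fifths_sq_le :
    (4 / 5 * Real.sqrt (2 * π * Real.exp 1) * Real.exp (-π * (4 / 5) ^ 2)) ^ 2 ≤ 1 / 5 := by
  have hπ := Real.pi_gt_d6
  have hπ' := Real.pi_lt_d6
  have he := Real.exp_one_lt_d9
  have he' := Real.exp_one_gt_d9
  have h2πe : 2 * π * Real.exp 1 ≤ 17.08 := by nlinarith [Real.exp_pos (1 : ℝ)]
  have hE : (55.75 : ℝ) ≤ Real.exp (32 * π / 25) := by
    calc (55.75 : ℝ) ≤ 2.7182818283 ^ 4 * (0.02123 + 1) := by norm_num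
      _ ≤ Real.exp 1 ^ 4 * Real.exp 0.02123 :=
          mul_le_mul (pow_le_pow_left₀ (by norm_num) he'.le 4) (Real.add_one_le_exp _) (by norm_num)
            (pow_nonneg (Real.exp_pos _).le _)
      _ = Real.exp (4 * 1 + 0.02123) := by
          rw [Real.exp_add, ← Real.exp_nat_mul]; norm_num
      _ ≤ Real.exp (32 * π / 25) := Real.exp_le_exp.2 (by linarith)
  have hexp2 : Real.exp (-π * (4 / 5) ^ 2) ^ 2 = (Real.exp (32 * π / 25))⁻¹ := by
    rw [← Real.exp_nat_mul, ← Real.exp_neg]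
    congr 1
    push_cast
    ring
  rw [mul_pow, mul_pow, Real.sq_sqrt (by positivity), hexp2]
  have hinv : (Real.exp (32 * π / 25))⁻¹ ≤ (55.75 : ℝ)⁻¹ := inv_anti₀ (by norm_num) hE
  calc (4 / 5 : ℝ) ^ 2 * (2 * π * Real.exp 1) * (Real.exp (32 * π / 25))⁻¹
      ≤ (4 / 5 : ℝ) ^ 2 * 17.08 * (55.75 : ℝ)⁻¹ := by
        gcongr
    _ ≤ 1 / 5 := by norm_num

/-! ### Geometry: dimension count and the choice of `u` -/

section Geometry

variable {E : Type*} [NormedAddCommGroup E] [InnerProductSpace ℝ E] [FiniteDimensional ℝ E]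

omit [FiniteDimensional ℝ E] in
/-- If `0 ≤ r < λ_k(Λ)` then the vectors of `Λ` of norm at most `r` span a subspace of dimension `< k`
(immediate from the definition of `λ_k` as an infimum; Banaszczyk, proof of Thm 2.1: "from (9) and (10)
we get `dim M ≤ i - 1` and `dim N ≤ n - i`"). [cite: Banaszczyk1993, Thm 2.1 (proof)] -/
theorem finrank_span_inter_closedBall_lt_of_lt_successiveMinimum (Λ : Submodule ℤ E) {k : ℕ}
    {r : ℝ} (hr : 0 ≤ r) (hrk : r < successiveMinimum Λ k) :
    finrank ℝ (Submodule.span ℝ ((Λ : Set E) ∩ closedBall (0 : E) r)) < k := by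
  by_contra! h
  have hle : successiveMinimum Λ k ≤ r := by
    unfold successiveMinimum
    exact csInf_le ⟨0, fun _ h' => h'.1⟩ ⟨hr, h⟩
  exact absurd hrk (not_lt.2 hle)

/-- If `dim M + dim N < dim E` then there is a vector of any prescribed length `t ≥ 0` orthogonal to
both `M` and `N` (Banaszczyk, proof of Thm 2.1: "`dim M⊥ + dim N⊥ ≥ n + 1`, and we can find a vector
`u ∈ M⊥ ∩ N⊥` with `‖u‖ = 3^{-1/2}`"). [cite: Banaszczyk1993, Thm 2.1 (proof)] -/
theorem exists_norm_eq_inner_eq_zero_of_finrank_add_lt (M N : Submodule ℝ E)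
    (h : finrank ℝ M + finrank ℝ N < finrank ℝ E) {t : ℝ} (ht : 0 ≤ t) :
    ∃ u : E, ‖u‖ = t ∧ (∀ v ∈ M, ⟪v, u⟫_ℝ = 0) ∧ ∀ w ∈ N, ⟪w, u⟫_ℝ = 0 := by
  have hlt : finrank ℝ ↥(M ⊔ N) < finrank ℝ E :=
    (Submodule.finrank_add_le_finrank_add_finrank M N).trans_lt h
  have hne : M ⊔ N ≠ ⊤ := by
    intro htop
    rw [htop, finrank_top] at hlt
    exact lt_irrefl _ hlt
  have hbot : (M ⊔ N)ᗮ ≠ ⊥ := by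
    rwa [Ne, Submodule.orthogonal_eq_bot_iff]
  obtain ⟨z, hz, hz0⟩ := Submodule.exists_mem_ne_zero_of_ne_bot hbot
  have hz' : ‖z‖ ≠ 0 := norm_ne_zero_iff.2 hz0
  refine ⟨(t / ‖z‖) • z, ?_, fun v hv => ?_, fun w hw => ?_⟩
  · rw [norm_smul, Real.norm_eq_abs, abs_of_nonneg (div_nonneg ht (norm_nonneg _)),
      div_mul_cancel₀ _ hz']
  · rw [real_inner_smul_right, Submodule.inner_right_of_mem_orthogonal (Submodule.mem_sup_left hv) hz,
      mul_zero]
  · rw [real_inner_smul_right, Submodule.inner_right_of_mem_orthogonal (Submodule.mem_sup_right hw) hz,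
      mul_zero]

end Geometry

/-! ### The two Gaussian estimates (Banaszczyk's (11) and (12)–(13)) -/

section Analytic

variable {V : Type*} [NormedAddCommGroup V] [InnerProductSpace ℝ V] [FiniteDimensional ℝ V]
  [MeasurableSpace V] [BorelSpace V]

variable (L : Submodule ℤ V) [DiscreteTopology L] [IsZLattice ℝ L]

/-- **Banaszczyk's (12)–(13)** (shifted Gaussian mass, upper bound): if `u` is orthogonal to every
lattice vector of norm `≤ r` and `a s √n ≤ r - ‖u‖` with `a ≥ 1/√(2π)`, then
`ρ_s(L - u) ≤ (ρ_s(u) + (a√(2πe) e^{-πa²})ⁿ) ρ_s(L)`: the vectors with `‖y‖ ≤ r` contribute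
`ρ_s(y - u) = ρ_s(u) ρ_s(y)` (Pythagoras), the others lie in the tail `‖y - u‖ ≥ a s √n` bounded by
Lemma 1.5(ii) (`tsum_indicator_gaussianFunction_sub_le`). [cite: Banaszczyk1993, Thm 2.1 (proof, (12)–(13))] -/
theorem tsum_gaussianFunction_sub_le_of_inner_eq_zero {s a r : ℝ} (hs : 0 < s)
    (ha : 1 / Real.sqrt (2 * π) ≤ a) {u : V} (horth : ∀ y ∈ L, ‖y‖ ≤ r → ⟪y, u⟫_ℝ = 0)
    (hr : a * s * Real.sqrt (finrank ℝ V) ≤ r - ‖u‖) :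
    ∑' y : L, gaussianFunction s ((y : V) - u) ≤
      (gaussianFunction s u +
          (a * Real.sqrt (2 * π * Real.exp 1) * Real.exp (-π * a ^ 2)) ^ finrank ℝ V) *
        ∑' y : L, gaussianFunction s (y : V) := by
  set T : Set L := {y : L | a * s * Real.sqrt (finrank ℝ V) ≤ ‖(y : V) - u‖} with hT
  set f : L → ℝ := fun y ↦ gaussianFunction s ((y : V) - u) with hf
  -- pointwise bound
  have hpt : ∀ y : L, f y ≤ gaussianFunction s u * gaussianFunction s (y : V) + T.indicator f y := by
    intro y
    by_cases hy : ‖(y : V)‖ ≤ r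
    · have h0 : ⟪(y : V), u⟫_ℝ = 0 := horth y y.2 hy
      have heq : f y = gaussianFunction s u * gaussianFunction s (y : V) := by
        simp only [hf, gaussianFunction, ← Real.exp_add]
        congr 1
        rw [norm_sub_sq_real, h0]
        ring
      rw [heq]
      exact le_add_of_nonneg_right
        (Set.indicator_nonneg (fun _ _ ↦ (gaussianFunction_pos _ _).le) _)
    · have hyT : y ∈ T := by
        push Not at hy
        change a * s * Real.sqrt (finrank ℝ V) ≤ ‖(y : V) - u‖
        have := norm_sub_norm_le (y : V) u
        linarith
      rw [Set.indicator_of_mem hyT]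
      exact le_add_of_nonneg_left
        (mul_pos (gaussianFunction_pos _ _) (gaussianFunction_pos _ _)).le
  have hS0 : Summable fun y : L ↦ gaussianFunction s (y : V) :=
    (summable_gaussianFunction_sub L hs.ne' 0).congr fun y ↦ by rw [sub_zero]
  have hSf : Summable f := summable_gaussianFunction_sub L hs.ne' u
  have hST : Summable (T.indicator f) :=
    Summable.of_nonneg_of_le (fun y ↦ Set.indicator_nonneg (fun _ _ ↦ (gaussianFunction_pos _ _).le) _)
      (fun y ↦ Set.indicator_le_self' (fun _ _ ↦ (gaussianFunction_pos _ _).le) y) hSf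
  have htail : ∑' y : L, T.indicator f y ≤
      (a * Real.sqrt (2 * π * Real.exp 1) * Real.exp (-π * a ^ 2)) ^ finrank ℝ V *
        ∑' y : L, gaussianFunction s (y : V) :=
    tsum_indicator_gaussianFunction_sub_le L hs ha u
  calc ∑' y : L, f y
      ≤ ∑' y : L, (gaussianFunction s u * gaussianFunction s (y : V) + T.indicator f y) :=
        Summable.tsum_le_tsum hpt hSf ((hS0.mul_left _).add hST)
    _ = gaussianFunction s u * ∑' y : L, gaussianFunction s (y : V) + ∑' y : L, T.indicator f y := by
        rw [Summable.tsum_add (hS0.mul_left _) hST, tsum_mul_left]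
    _ ≤ gaussianFunction s u * ∑' y : L, gaussianFunction s (y : V) +
        (a * Real.sqrt (2 * π * Real.exp 1) * Real.exp (-π * a ^ 2)) ^ finrank ℝ V *
          ∑' y : L, gaussianFunction s (y : V) := by linarith
    _ = _ := by ring

omit [IsZLattice ℝ L] in
/-- **Banaszczyk's (11)** (cosine sum, lower bound): if `u` is orthogonal to every vector of the full
lattice `Λ` of norm `≤ r` and `b σ √n ≤ r` with `b ≥ 1/√(2π)`, then
`∑_{w ∈ Λ} ρ_σ(w) cos(2π⟪u, w⟫) ≥ (1 - 2(b√(2πe) e^{-πb²})ⁿ) ρ_σ(Λ)`: `cos = 1` on the vectors with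
`‖w‖ ≤ r`, `cos ≥ -1` on the others, which lie in the tail `‖w‖ ≥ b σ √n` bounded by Lemma 1.5(i)
(`tsum_indicator_gaussianFunction_le`). [cite: Banaszczyk1993, Thm 2.1 (proof, (11))] -/
theorem tsum_gaussianFunction_mul_cos_ge (Λ : Submodule ℤ V) [DiscreteTopology Λ] [IsZLattice ℝ Λ]
    {σ b r : ℝ} (hσ : 0 < σ) (hb : 1 / Real.sqrt (2 * π) ≤ b) {u : V}
    (horth : ∀ w ∈ Λ, ‖w‖ ≤ r → ⟪u, w⟫_ℝ = 0) (hr : b * σ * Real.sqrt (finrank ℝ V) ≤ r) :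
    (1 - 2 * (b * Real.sqrt (2 * π * Real.exp 1) * Real.exp (-π * b ^ 2)) ^ finrank ℝ V) *
        ∑' w : Λ, gaussianFunction σ (w : V) ≤
      ∑' w : Λ, gaussianFunction σ (w : V) * Real.cos (2 * π * ⟪u, (w : V)⟫_ℝ) := by
  set T : Set Λ := {w : Λ | b * σ * Real.sqrt (finrank ℝ V) ≤ ‖(w : V)‖} with hT
  set g : Λ → ℝ := fun w ↦ gaussianFunction σ (w : V) with hg
  have hpt : ∀ w : Λ,
      g w - 2 * T.indicator g w ≤ gaussianFunction σ (w : V) * Real.cos (2 * π * ⟪u, (w : V)⟫_ℝ) := by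
    intro w
    have hind : 0 ≤ T.indicator g w :=
      Set.indicator_nonneg (fun _ _ ↦ (gaussianFunction_pos _ _).le) _
    by_cases hw : ‖(w : V)‖ ≤ r
    · rw [horth w w.2 hw, mul_zero, Real.cos_zero, mul_one]
      change gaussianFunction σ (w : V) - 2 * T.indicator g w ≤ gaussianFunction σ (w : V)
      linarith
    · have hwT : w ∈ T := by
        push Not at hw
        change b * σ * Real.sqrt (finrank ℝ V) ≤ ‖(w : V)‖
        linarith
      rw [Set.indicator_of_mem hwT]
      have hc := Real.neg_one_le_cos (2 * π * ⟪u, (w : V)⟫_ℝ)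
      have hg0 := (gaussianFunction_pos σ (w : V)).le
      change gaussianFunction σ (w : V) - 2 * gaussianFunction σ (w : V) ≤ _
      nlinarith
  have hS0 : Summable g := (summable_gaussianFunction_sub Λ hσ.ne' 0).congr fun y ↦ by
    simp only [hg, sub_zero]
  have hST : Summable (T.indicator g) :=
    Summable.of_nonneg_of_le (fun y ↦ Set.indicator_nonneg (fun _ _ ↦ (gaussianFunction_pos _ _).le) _)
      (fun y ↦ Set.indicator_le_self' (fun _ _ ↦ (gaussianFunction_pos _ _).le) y) hS0
  have htail : ∑' w : Λ, T.indicator g w ≤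
      (b * Real.sqrt (2 * π * Real.exp 1) * Real.exp (-π * b ^ 2)) ^ finrank ℝ V * ∑' w : Λ, g w :=
    tsum_indicator_gaussianFunction_le Λ hσ hb
  have hcos := summable_gaussianFunction_mul_cos Λ hσ.ne' u
  calc (1 - 2 * (b * Real.sqrt (2 * π * Real.exp 1) * Real.exp (-π * b ^ 2)) ^ finrank ℝ V) *
        ∑' w : Λ, g w
      = ∑' w : Λ, g w -
          2 * ((b * Real.sqrt (2 * π * Real.exp 1) * Real.exp (-π * b ^ 2)) ^ finrank ℝ V *
            ∑' w : Λ, g w) := by ring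
    _ ≤ ∑' w : Λ, g w - 2 * ∑' w : Λ, T.indicator g w := by linarith
    _ = ∑' w : Λ, (g w - 2 * T.indicator g w) := by
        rw [Summable.tsum_sub hS0 (hST.mul_left 2), tsum_mul_left]
    _ ≤ ∑' w : Λ, gaussianFunction σ (w : V) * Real.cos (2 * π * ⟪u, (w : V)⟫_ℝ) :=
        Summable.tsum_le_tsum hpt (hS0.sub (hST.mul_left 2)) hcos

end Analytic

/-! ### The case `n = 1` -/

section DimOne

variable {E : Type*} [NormedAddCommGroup E] [InnerProductSpace ℝ E] [FiniteDimensional ℝ E]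

/-- **The case `n = 1` of Banaszczyk's Thm 2.1**: `λ₁(L) λ₁(L*) ≤ 1` for a full lattice `L` of a
one-dimensional space ("If `n = 1`, then `λ₁(L)λ₁(L*) = 1`", p. 631): a shortest vector `v` generates
`L` (a lattice vector `c • v` with `c ∉ ℤ` would give the shorter vector `fract(c) • v`), so
`v/‖v‖² ∈ L*` has norm `1/λ₁(L)`. [cite: Banaszczyk1993, Thm 2.1 (proof, case n = 1)] -/
theorem minNorm_mul_minNorm_dualLattice_le_one (L : Submodule ℤ E) [DiscreteTopology L]
    [IsZLattice ℝ L] (h1 : finrank ℝ E = 1) : minNorm L * minNorm (dualLattice L) ≤ 1 := by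
  haveI : Nontrivial E := Module.nontrivial_of_finrank_eq_succ h1
  have hL : L ≠ ⊥ := by
    intro hbot
    have hspan : Submodule.span ℝ ((L : Submodule ℤ E) : Set E) = ⊤ := IsZLattice.span_top
    rw [hbot, Submodule.bot_coe, Submodule.span_zero_singleton] at hspan
    exact bot_ne_top hspan
  obtain ⟨v, hvL, hv0, hvmin⟩ := exists_mem_norm_eq_minNorm_holds L hL
  have hvpos : 0 < ‖v‖ := norm_pos_iff.2 hv0
  have hbdd : ∀ Λ : Submodule ℤ E, BddBelow ((‖·‖) '' {x : E | x ∈ Λ ∧ x ≠ 0}) := fun Λ =>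
    ⟨0, by rintro _ ⟨x, -, rfl⟩; exact norm_nonneg x⟩
  -- every lattice vector is an integer multiple of the shortest vector `v`
  have hmul : ∀ y ∈ L, ∃ k : ℤ, (k : ℝ) • v = y := by
    intro y hy
    obtain ⟨c, rfl⟩ := (finrank_eq_one_iff_of_nonzero' v hv0).1 h1 y
    refine ⟨⌊c⌋, ?_⟩
    have hmem : Int.fract c • v ∈ L := by
      have : Int.fract c • v = c • v - ((⌊c⌋ : ℤ) : ℝ) • v := by rw [Int.fract, sub_smul]
      rw [this, Int.cast_smul_eq_zsmul ℝ ⌊c⌋ v]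
      exact L.sub_mem hy (L.smul_mem ⌊c⌋ hvL)
    by_contra hne
    have hfr0 : Int.fract c ≠ 0 := by
      intro h0
      apply hne
      have := Int.floor_add_fract c
      rw [h0, add_zero] at this
      rw [this]
    have hlt : ‖Int.fract c • v‖ < minNorm L := by
      rw [norm_smul, Real.norm_eq_abs, abs_of_nonneg (Int.fract_nonneg c), ← hvmin]
      exact mul_lt_of_lt_one_left hvpos (Int.fract_lt_one c)
    have hle : minNorm L ≤ ‖Int.fract c • v‖ :=
      csInf_le (hbdd L) ⟨_, ⟨hmem, smul_ne_zero hfr0 hv0⟩, rfl⟩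
    exact absurd hlt (not_lt.2 hle)
  -- the dual vector `v / ‖v‖²`
  set w : E := (‖v‖ ^ 2)⁻¹ • v with hw_def
  have hw : w ∈ dualLattice L := by
    refine mem_dualLattice.2 fun y hy => ?_
    obtain ⟨k, rfl⟩ := hmul y hy
    refine ⟨k, ?_⟩
    rw [hw_def, real_inner_smul_left, real_inner_smul_right, real_inner_self_eq_norm_sq]
    field_simp
  have hw0 : w ≠ 0 := smul_ne_zero (inv_ne_zero (pow_ne_zero 2 hvpos.ne')) hv0
  have hwn : ‖w‖ = ‖v‖⁻¹ := by
    rw [hw_def, norm_smul, norm_inv, Real.norm_eq_abs, abs_of_nonneg (sq_nonneg _)]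
    field_simp
  have hdual : minNorm (dualLattice L) ≤ ‖v‖⁻¹ :=
    hwn ▸ csInf_le (hbdd _) ⟨w, ⟨hw, hw0⟩, rfl⟩
  calc minNorm L * minNorm (dualLattice L) ≤ ‖v‖ * ‖v‖⁻¹ := by
        rw [← hvmin]
        exact mul_le_mul_of_nonneg_left hdual (norm_nonneg v)
    _ = 1 := mul_inv_cancel₀ hvpos.ne'

end DimOne

/-! ### The case `n ≥ 2` and the discharge -/

section Transference

variable {E : Type*} [NormedAddCommGroup E] [InnerProductSpace ℝ E] [FiniteDimensional ℝ E]

/-- **Banaszczyk's Thm 2.1 for `n ≥ 2`** (the Fourier-analytic argument of pp. 631–632 with radii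
`(5/4)s√n`, `(4/5)√n/s` and `‖u‖ = (9/20)s√n`, see the module docstring): for a full lattice `L` of an
`n`-dimensional space, `n ≥ 2`, and `i ≤ n`, `λᵢ(L) λ_{n+1-i}(L*) ≤ n` (for `i = 0` the left
factor is the junk value `λ₀ = 0`). [cite: Banaszczyk1993, Thm 2.1] -/
theorem successiveMinimum_mul_dual_le_of_two_le (L : Submodule ℤ E) [DiscreteTopology L]
    [IsZLattice ℝ L] (h2 : 2 ≤ finrank ℝ E) {i : ℕ} (hi' : i ≤ finrank ℝ E) :
    successiveMinimum L i * successiveMinimum (dualLattice L) (finrank ℝ E + 1 - i) ≤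
      finrank ℝ E := by
  borelize E
  set n := finrank ℝ E with hn
  set P := successiveMinimum L i with hP
  set Q := successiveMinimum (dualLattice L) (n + 1 - i) with hQ
  have hP0 : 0 ≤ P := successiveMinimum_nonneg L i
  have hQ0 : 0 ≤ Q := successiveMinimum_nonneg _ _
  by_contra! hPQ
  have hn0 : (0 : ℝ) < n := by
    have : (2 : ℝ) ≤ n := by exact_mod_cast h2
    linarith
  have hPQ0 : 0 < P * Q := hn0.trans hPQ
  have hPpos : 0 < P := by
    rcases hP0.eq_or_lt with h | h
    · rw [← h, zero_mul] at hPQ0; exact absurd hPQ0 (lt_irrefl 0)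
    · exact h
  have hQpos : 0 < Q := by
    rcases hQ0.eq_or_lt with h | h
    · rw [← h, mul_zero] at hPQ0; exact absurd hPQ0 (lt_irrefl 0)
    · exact h
  -- radii `r₁ < P`, `r₂ < Q` with `r₁ r₂ = n`
  have hlt1 : (n : ℝ) / (P * Q) < 1 := (div_lt_one hPQ0).2 hPQ
  set t : ℝ := ((n : ℝ) / (P * Q) + 1) / 2 with ht
  have ht1 : t < 1 := by rw [ht]; linarith
  have htl : (n : ℝ) / (P * Q) < t := by rw [ht]; linarith
  have ht0 : 0 < t := (div_pos hn0 hPQ0).trans htl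
  set r₂ : ℝ := Q * t with hr₂
  have hr₂0 : 0 < r₂ := mul_pos hQpos ht0
  have hr₂Q : r₂ < Q := mul_lt_of_lt_one_right hQpos ht1
  set r₁ : ℝ := n / r₂ with hr₁
  have hr₁0 : 0 < r₁ := div_pos hn0 hr₂0
  have hr₁P : r₁ < P := by
    rw [hr₁, div_lt_iff₀ hr₂0, hr₂]
    have h := (div_lt_iff₀ hPQ0).1 htl
    nlinarith
  have hr₁r₂ : r₁ * r₂ = n := div_mul_cancel₀ _ hr₂0.ne'
  -- the spans of the short vectors and their dimensions
  set M := Submodule.span ℝ ((L : Set E) ∩ closedBall (0 : E) r₁) with hM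
  set N := Submodule.span ℝ ((dualLattice L : Set E) ∩ closedBall (0 : E) r₂) with hN
  have hMi : finrank ℝ M < i :=
    finrank_span_inter_closedBall_lt_of_lt_successiveMinimum L hr₁0.le hr₁P
  have hNi : finrank ℝ N < n + 1 - i :=
    finrank_span_inter_closedBall_lt_of_lt_successiveMinimum (dualLattice L) hr₂0.le hr₂Q
  have hMN : finrank ℝ M + finrank ℝ N < finrank ℝ E := by omega
  -- the vector `u ⊥ M, N` of norm `(9/25) r₁`
  obtain ⟨u, hu, huM, huN⟩ :=
    exists_norm_eq_inner_eq_zero_of_finrank_add_lt M N hMN (t := 9 / 25 * r₁) (by positivity)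
  have horth₁ : ∀ y ∈ L, ‖y‖ ≤ r₁ → ⟪y, u⟫_ℝ = 0 := fun y hy hyr ↦
    huM y (Submodule.subset_span ⟨hy, mem_closedBall_zero_iff.2 hyr⟩)
  have horth₂ : ∀ w ∈ dualLattice L, ‖w‖ ≤ r₂ → ⟪u, w⟫_ℝ = 0 := fun w hw hwr ↦ by
    rw [real_inner_comm]
    exact huN w (Submodule.subset_span ⟨hw, mem_closedBall_zero_iff.2 hwr⟩)
  -- the Gaussian parameter `s = (4/5) √n / r₂`
  have ha : 1 / Real.sqrt (2 * π) ≤ 4 / 5 := one_div_sqrt_two_pi_le_four_fifths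
  have hsqrt0 : 0 < Real.sqrt n := Real.sqrt_pos.2 hn0
  set s : ℝ := 4 / 5 * Real.sqrt n / r₂ with hs_def
  have hs : 0 < s := div_pos (mul_pos (by norm_num) hsqrt0) hr₂0
  have hsn : Real.sqrt n * Real.sqrt n = n := Real.mul_self_sqrt hn0.le
  have hasn : 4 / 5 * s * Real.sqrt n = 16 / 25 * r₁ := by
    rw [hs_def, hr₁, show (4 : ℝ) / 5 * (4 / 5 * Real.sqrt n / r₂) * Real.sqrt n =
      16 / 25 * (Real.sqrt n * Real.sqrt n) / r₂ by ring, hsn]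
    ring
  have hbsn : 4 / 5 * s⁻¹ * Real.sqrt n = r₂ := by
    rw [hs_def]
    field_simp
  -- the two estimates and the Poisson identity
  have hup := tsum_gaussianFunction_sub_le_of_inner_eq_zero L hs ha horth₁ (r := r₁)
    (by rw [hasn, hu]; linarith)
  have hlow := tsum_gaussianFunction_mul_cos_ge (dualLattice L) (inv_pos.2 hs) ha horth₂ hbsn.le
  have hid := tsum_gaussianFunction_sub_div_eq L hs u
  set B : ℝ := 4 / 5 * Real.sqrt (2 * π * Real.exp 1) * Real.exp (-π * (4 / 5) ^ 2) with hB
  have hρL : 0 < ∑' y : L, gaussianFunction s (y : E) := by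
    have := tsum_gaussianFunction_sub_pos L hs.ne' (0 : E)
    simpa only [sub_zero] using this
  have hρL' : 0 < ∑' w : dualLattice L, gaussianFunction s⁻¹ (w : E) := by
    have := tsum_gaussianFunction_sub_pos (dualLattice L) (inv_ne_zero hs.ne') (0 : E)
    simpa only [sub_zero] using this
  -- `1 - 2 Bⁿ ≤ ρ_s(u) + Bⁿ`
  have hmain : 1 - 2 * B ^ n ≤ gaussianFunction s u + B ^ n := by
    have h₁ : (∑' y : L, gaussianFunction s ((y : E) - u)) / ∑' y : L, gaussianFunction s (y : E) ≤
        gaussianFunction s u + B ^ n := by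
      rw [div_le_iff₀ hρL]
      exact hup
    have h₂ : 1 - 2 * B ^ n ≤
        (∑' w : dualLattice L, gaussianFunction s⁻¹ (w : E) * Real.cos (2 * π * ⟪u, (w : E)⟫_ℝ)) /
          ∑' w : dualLattice L, gaussianFunction s⁻¹ (w : E) := by
      rw [le_div_iff₀ hρL']
      exact hlow
    rw [← hid] at h₂
    exact h₂.trans h₁
  -- `ρ_s(u) = e^{-81πn/400}`
  have hx : gaussianFunction s u = Real.exp (-(81 * π / 400)) ^ n := by
    rw [gaussianFunction, ← Real.exp_nat_mul]
    congr 1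
    have hs2 : s ^ 2 = (4 / 5) ^ 2 * n / r₂ ^ 2 := by
      rw [hs_def, div_pow, mul_pow, Real.sq_sqrt hn0.le]
    have hu2 : ‖u‖ ^ 2 = (9 / 25) ^ 2 * r₁ ^ 2 := by rw [hu, mul_pow]
    rw [hu2, hs2, hr₁]
    field_simp
    ring
  -- numerics
  have hB0 : 0 ≤ B := by positivity
  have hB2 : B ^ 2 ≤ 1 / 5 := banaszczykConst_four_fifths_sq_le
  have hB1 : B ≤ 1 := by nlinarith
  have hBn : B ^ n ≤ 1 / 5 := (pow_le_pow_of_le_one hB0 hB1 h2).trans hB2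
  have hx0 : 0 ≤ Real.exp (-(81 * π / 400)) := (Real.exp_pos _).le
  have hx1 : Real.exp (-(81 * π / 400)) ≤ 1 := by
    rw [Real.exp_le_one_iff]
    have := Real.pi_pos
    linarith
  have hxn : Real.exp (-(81 * π / 400)) ^ n ≤ 29 / 100 :=
    (pow_le_pow_of_le_one hx0 hx1 h2).trans exp_neg_pi_mul_le
  rw [hx] at hmain
  linarith

/-- **Discharge of `successiveMinimum_mul_dual_le`** (pqc.S24; Banaszczyk, Math. Ann. 296 (1993),
Theorem (2.1), p. 631: "Let `L` be an arbitrary lattice in `ℝⁿ`, `n ≥ 1`. Then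
`λᵢ(L) λ_{n-i+1}(L*) ≤ n` (`i = 1, …, n`)."): for a full-rank lattice `L` in an `n`-dimensional real
inner product space and `1 ≤ i ≤ n`, `λᵢ(L) · λ_{n+1-i}(L*) ≤ n`. Case `n = 1` by
`minNorm_mul_minNorm_dualLattice_le_one`, case `n ≥ 2` by `successiveMinimum_mul_dual_le_of_two_le`
(Banaszczyk's Gaussian argument). [cite: Banaszczyk1993, Thm 2.1 (p. 631)] -/
theorem successiveMinimum_mul_dual_le_holds : successiveMinimum_mul_dual_le (E := E) := by
  intro L _ _ i hi hi'
  rcases (hi.trans hi').eq_or_lt with h1 | h2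
  · have hi1 : i = 1 := by omega
    subst hi1
    have hidx : finrank ℝ E + 1 - 1 = 1 := by omega
    have hL1 : successiveMinimum L 1 = minNorm L := successiveMinimum_one_eq_minNorm_holds L
    have hL2 : successiveMinimum (dualLattice L) 1 = minNorm (dualLattice L) :=
      successiveMinimum_one_eq_minNorm_holds (dualLattice L)
    rw [hidx, hL1, hL2, ← h1, Nat.cast_one]
    exact minNorm_mul_minNorm_dualLattice_le_one L h1.symm
  · exact successiveMinimum_mul_dual_le_of_two_le L h2 hi'

/-- **Discharge of `minNorm_mul_successiveMinimum_dual_le`** (pqc.S24, case `i = 1`; Banaszczyk 1993,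
Thm 2.1 with `i = 1`): `λ₁(L) · λₙ(L*) ≤ n` for a full-rank lattice `L` in an `n`-dimensional real
inner product space, `n ≠ 0`. From `successiveMinimum_mul_dual_le_holds` at `i = 1` and
`λ₁ = minNorm` (`successiveMinimum_one_eq_minNorm_holds`); this restores the interim proof recorded
as a comment in `LatticeGeometry.lean`. [cite: Banaszczyk1993, Thm 2.1 (p. 631)] -/
theorem minNorm_mul_successiveMinimum_dual_le_holds :
    minNorm_mul_successiveMinimum_dual_le (E := E) := by
  intro L _ _ hn
  have h := successiveMinimum_mul_dual_le_holds L (i := 1) le_rfl (Nat.one_le_iff_ne_zero.mpr hn)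
  have hL1 : successiveMinimum L 1 = minNorm L := successiveMinimum_one_eq_minNorm_holds L
  rw [hL1, Nat.add_sub_cancel] at h
  exact h

end Transference

end Literature.Algebra.EuclideanLattices

end
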